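import Literature.NumberTheory.Sieve.LinearEquationsInPrimesLevelTwoInputs
import Literature.NumberTheory.Sieve.LinearEquationsInPrimesHeisenbergBoxMetric
import HarnessLib

/-!
# Route `GreenTaoLevelTwo`, crux `MNTwo` (stmt-Parity-21276), line `birth`: central translations in
# the Heisenberg class (input of the vertical-reduction stub `stub_verticalReduction`)

The vertical Fourier expansion of Green–Tao 2012a Lemma 3.7 integrates a Lipschitz `F` over the
translates `F(z · x)` by CENTRAL elements `z`.  Two metric facts about central translations are
used for every member of the Heisenberg class (and every Def-8.1 box-comparable metric `d`):

* central translations are UNIFORMLY LIPSCHITZ: `d(z·p, z·q) ≤ L_c d(p, q)` (so the vertical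
  components `F_ξ(x) = ∫ e(-ξ·t) F(ι(t)x) dt` inherit the Lipschitz constant `L_c M` of `F`,
  independently of `ξ`);
* central translations MOVE POINTS LITTLE: `d(ι(t)·p, p) ≤ L₁ |t|` (so smoothing `F` along the
  centre at scale `s` costs `M L₁ s`).

This file proves them for the generators of the class — the re-metrised Heisenberg nilmanifold
`heisenbergWith d h` (via the exact invariance of the box pre-distance `ρ₀` under central
translations and bi-Lipschitz comparability, `L_c = L²`, `L₁ = L`) and the circle (isometric
translations) — together with the algebra they rest on: the centre of `H³(ℝ)` is `{(0,0,t)}`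
(`= Heis.centerZ = [G,G]`), the one-parameter central subgroup `t ↦ (0,0,t)` (a continuous
homomorphism onto the centre with integer points in `Γ`), and the centre / translations of the
circle.  All statements are definition-free helper lemmas.

References: B. Green, T. Tao, *The Möbius function is strongly orthogonal to nilsequences*,
Ann. of Math. 175 (2012), Lemma 3.7 [GreenTao2012Mobius]; B. Green, T. Tao, *An inverse theorem
for the Gowers U³(G) norm*, Proc. Edinb. Math. Soc. 51 (2008), §12 (the cube metric)
[GreenTao2008U3Inverse]; B. Green, T. Tao, *Linear equations in primes*, Ann. of Math. 171 (2010),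
Def. 8.1 [GreenTao2010].
-/

noncomputable section

open Literature.NumberTheory.Sieve
open Literature.NumberTheory.Sieve.GreenTaoLevelTwo (HX IsCompatMetric IsBoxComparable heisenbergWith
  InHeisClass boxGauge heisPreDist)

namespace Summit.Parity.GeneralizedHardyLittlewood.GreenTaoLevelTwoMNTwoCentralTranslation

/-! ### §1 The centre of the Heisenberg group -/

/-- The centre of `H³(ℝ)` consists of the elements `(0, 0, t)`. [folklore] -/
theorem mem_center_heis_iff (g : Heis) : g ∈ Subgroup.center Heis ↔ g.x = 0 ∧ g.y = 0 := by
  rw [Subgroup.mem_center_iff]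
  constructor
  · intro h
    have h1 := congrArg Heis.z (h (Heis.mk 1 0 0))
    have h2 := congrArg Heis.z (h (Heis.mk 0 1 0))
    simp only [Heis.z_mul, Heis.x_mk, Heis.y_mk, Heis.z_mk] at h1 h2
    constructor <;> linarith
  · rintro ⟨hx, hy⟩ h
    apply Heis.ext
    · simp only [Heis.x_mul]; ring
    · simp only [Heis.y_mul]; ring
    · simp only [Heis.z_mul, hx, hy]; ring

/-- `Z(H³(ℝ)) = {(0,0,t)} = Heis.centerZ` (`= [G, G]`, `Heis.commutator_eq_centerZ`). [folklore] -/
theorem center_heis_eq_centerZ : Subgroup.center Heis = Heis.centerZ :=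
  Subgroup.ext fun g => (mem_center_heis_iff g).trans Heis.mem_centerZ.symm

/-- A central element of `H³(ℝ)` is `(0, 0, t)` with `t` its `z`-coordinate. [folklore] -/
theorem eq_mk_of_mem_center {z : Heis} (hz : z ∈ Subgroup.center Heis) : z = Heis.mk 0 0 z.z := by
  obtain ⟨hx, hy⟩ := (mem_center_heis_iff z).mp hz
  apply Heis.ext <;> simp [hx, hy]

/-! ### §2 The one-parameter central subgroup `t ↦ (0, 0, t)` -/

/-- `(0,0,t)` is central. [folklore] -/
theorem mk_zero_zero_mem_center (t : ℝ) : Heis.mk 0 0 t ∈ Subgroup.center Heis :=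
  (mem_center_heis_iff _).mpr ⟨rfl, rfl⟩

/-- `t ↦ (0,0,t)` is a homomorphism `(ℝ, +) → Z(H³(ℝ))`. [folklore] -/
theorem mk_zero_zero_add (t u : ℝ) : Heis.mk 0 0 (t + u) = Heis.mk 0 0 t * Heis.mk 0 0 u := by
  apply Heis.ext <;> simp

/-- `(0,0,0) = 1`. [folklore] -/
theorem mk_zero_zero_zero : Heis.mk 0 0 0 = 1 := rfl

/-- `(0,0,t)⁻¹ = (0,0,-t)`. [folklore] -/
theorem mk_zero_zero_inv (t : ℝ) : (Heis.mk 0 0 t)⁻¹ = Heis.mk 0 0 (-t) := by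
  apply Heis.ext <;> simp

/-- Integer points of the central subgroup lie in the lattice `Γ = H³(ℤ)`. [folklore] -/
theorem mk_zero_zero_intCast_mem_latticeΓ (n : ℤ) : Heis.mk 0 0 n ∈ Heis.latticeΓ := by
  have h := Heis.mk_int_mem 0 0 n
  simp only [Int.cast_zero] at h
  exact h

/-- `t ↦ (0,0,t)` is continuous. [folklore] -/
theorem continuous_mk_zero_zero : Continuous fun t : ℝ => Heis.mk 0 0 t :=
  Heis.continuous_mk continuous_const continuous_const continuous_id

/-- `t ↦ (0,0,t)` maps ONTO the centre. [folklore] -/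
theorem exists_eq_mk_zero_zero_of_mem_center {z : Heis} (hz : z ∈ Subgroup.center Heis) :
    ∃ t : ℝ, Heis.mk 0 0 t = z :=
  ⟨z.z, (eq_mk_of_mem_center hz).symm⟩

/-- The box gauge of a central element: `S((0,0,t)) = |t|`.
[cite: GreenTao2008U3Inverse, §12 (the cube metric)] -/
theorem boxGauge_mk_zero_zero (t : ℝ) : boxGauge (Heis.mk 0 0 t) = |t| := by
  unfold GreenTaoLevelTwo.boxGauge
  simp only [Heis.x_mk, Heis.y_mk, Heis.z_mk, Heis.x_inv, Heis.y_inv, Heis.z_inv, neg_zero,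
    abs_zero, mul_zero, add_zero, abs_neg]
  have h0 : (0 : ℝ) ≤ |t| := abs_nonneg t
  simp [h0]

/-! ### §3 The box pre-distance `ρ₀` under central translations -/

/-- **`ρ₀` is invariant under central translations**: `ρ₀(z·p, z·q) = ρ₀(p, q)` for central `z`
(`z g γ (z h)⁻¹ = g γ h⁻¹`). [cite: GreenTao2008U3Inverse, §12 (the cube metric)] -/
theorem heisPreDist_center_smul {z : Heis} (hz : z ∈ Subgroup.center Heis) (p q : HX) :
    heisPreDist (z • p) (z • q) = heisPreDist p q := by
  obtain ⟨g, rfl⟩ := QuotientGroup.mk_surjective p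
  obtain ⟨h, rfl⟩ := QuotientGroup.mk_surjective q
  rw [MulAction.Quotient.smul_mk, MulAction.Quotient.smul_mk, smul_eq_mul, smul_eq_mul,
    GreenTaoLevelTwo.heisPreDist_mk, GreenTaoLevelTwo.heisPreDist_mk]
  refine iInf_congr fun γ => ?_
  rw [Subgroup.mem_center_iff] at hz
  have hc : z * (g * (γ : Heis) * h⁻¹) = g * (γ : Heis) * h⁻¹ * z := (hz _).symm
  congr 1
  calc z * g * (γ : Heis) * (z * h)⁻¹ = z * (g * (γ : Heis) * h⁻¹) * z⁻¹ := by group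
    _ = g * (γ : Heis) * h⁻¹ * z * z⁻¹ := by rw [hc]
    _ = g * (γ : Heis) * h⁻¹ := by group

/-- **Central translations move points little for `ρ₀`**: `ρ₀((0,0,t)·p, p) ≤ |t|` (take `γ = 1`:
`S((0,0,t)) = |t|`). [cite: GreenTao2008U3Inverse, §12 (the cube metric)] -/
theorem heisPreDist_mk_zero_zero_smul_le (t : ℝ) (p : HX) :
    heisPreDist (Heis.mk 0 0 t • p) p ≤ |t| := by
  obtain ⟨g, rfl⟩ := QuotientGroup.mk_surjective p
  rw [MulAction.Quotient.smul_mk, smul_eq_mul]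
  refine (GreenTaoLevelTwo.heisPreDist_mk_le (Heis.mk 0 0 t * g) g 1).trans (le_of_eq ?_)
  rw [Subgroup.coe_one, mul_one, mul_inv_cancel_right, boxGauge_mk_zero_zero]

/-! ### §4 Box-comparable Def-8.1 metrics under central translations -/

/-- **Central translations are uniformly Lipschitz** for any metric `d` bi-Lipschitz comparable
(constant `L`) to `ρ₀`: `d(z·p, z·q) ≤ L² d(p, q)`. [cite: GreenTao2012Mobius, Lemma 3.7] -/
theorem dist_center_smul_le {d : HX → HX → ℝ} {L : ℝ} (hL0 : 0 ≤ L)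
    (hL : ∀ p q, heisPreDist p q ≤ L * d p q ∧ d p q ≤ L * heisPreDist p q)
    {z : Heis} (hz : z ∈ Subgroup.center Heis) (p q : HX) :
    d (z • p) (z • q) ≤ L ^ 2 * d p q := by
  calc d (z • p) (z • q) ≤ L * heisPreDist (z • p) (z • q) := (hL _ _).2
    _ = L * heisPreDist p q := by rw [heisPreDist_center_smul hz]
    _ ≤ L * (L * d p q) := mul_le_mul_of_nonneg_left (hL p q).1 hL0
    _ = L ^ 2 * d p q := by ring

/-- **Central translations move points little** for any metric `d` bi-Lipschitz comparable
(constant `L`) to `ρ₀`: `d((0,0,t)·p, p) ≤ L |t|`. [cite: GreenTao2012Mobius, Lemma 3.7] -/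
theorem dist_mk_zero_zero_smul_le {d : HX → HX → ℝ} {L : ℝ} (hL0 : 0 ≤ L)
    (hL : ∀ p q, heisPreDist p q ≤ L * d p q ∧ d p q ≤ L * heisPreDist p q) (t : ℝ) (p : HX) :
    d (Heis.mk 0 0 t • p) p ≤ L * |t| :=
  (hL _ _).2.trans (mul_le_mul_of_nonneg_left (heisPreDist_mk_zero_zero_smul_le t p) hL0)

/-- The two bounds for a box-comparable metric, with the comparability constant extracted: there is
`L > 0` with `d(z·p, z·q) ≤ L² d(p,q)` for all central `z` and `d((0,0,t)·p, p) ≤ L|t|`.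
[cite: GreenTao2012Mobius, Lemma 3.7] -/
theorem exists_central_bounds {d : HX → HX → ℝ} (hd : IsBoxComparable d) :
    ∃ L : ℝ, 0 < L ∧
      (∀ z ∈ Subgroup.center Heis, ∀ p q : HX, d (z • p) (z • q) ≤ L ^ 2 * d p q) ∧
      (∀ (t : ℝ) (p : HX), d (Heis.mk 0 0 t • p) p ≤ L * |t|) := by
  obtain ⟨L, hL0, hL⟩ := hd
  exact ⟨L, hL0, fun z hz p q => dist_center_smul_le hL0.le hL hz p q,
    fun t p => dist_mk_zero_zero_smul_le hL0.le hL t p⟩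

/-! ### §5 The circle: centre and translations -/

/-- The circle group `ℝ` (written multiplicatively) is abelian: its centre is everything.
[folklore] -/
theorem center_circle_eq_top : Subgroup.center Nilmanifold.circle.G = ⊤ :=
  CommGroup.center_eq_top (G := Multiplicative ℝ)

/-- Translation of a point of the circle nilmanifold: `t · (a + ℤ) = (t + a) + ℤ`. [folklore] -/
theorem circleElt_smul_circlePt (t a : ℝ) :
    Nilmanifold.circleElt t • circlePt a = circlePt (t + a) := by
  rw [← Nilmanifold.mk_circleElt a, MulAction.Quotient.smul_mk, smul_eq_mul, Nilmanifold.circleElt_mul,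
    Nilmanifold.mk_circleElt]

/-- **Translations of the circle are isometries** of the quotient metric of `ℝ/ℤ`. [folklore] -/
theorem circle_dist_smul (t : ℝ) (p q : Nilmanifold.circle.G ⧸ Nilmanifold.circle.Γ) :
    Nilmanifold.circle.dist (Nilmanifold.circleElt t • p) (Nilmanifold.circleElt t • q) =
      Nilmanifold.circle.dist p q := by
  obtain ⟨a, rfl⟩ := exists_eq_circlePt p
  obtain ⟨b, rfl⟩ := exists_eq_circlePt q
  rw [circleElt_smul_circlePt, circleElt_smul_circlePt, circle_dist_circlePt, circle_dist_circlePt]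
  congr 1
  ring_nf

/-- **Translations of the circle move points little**: `d((t + a) + ℤ, a + ℤ) ≤ |t|`. [folklore] -/
theorem circle_dist_smul_self_le (t : ℝ) (p : Nilmanifold.circle.G ⧸ Nilmanifold.circle.Γ) :
    Nilmanifold.circle.dist (Nilmanifold.circleElt t • p) p ≤ |t| := by
  obtain ⟨a, rfl⟩ := exists_eq_circlePt p
  rw [circleElt_smul_circlePt, circle_dist_circlePt]
  have h : t + a - a = t := by ring
  rw [h]
  -- `|t - round t| ≤ |t - 0| = |t|`
  have := round_le t 0
  simpa using this

/-- Integer translations are lattice elements of the circle nilmanifold (`Γ = ℤ`). [folklore] -/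
theorem circleElt_intCast_mem_Γ (n : ℤ) : Nilmanifold.circleElt (n : ℝ) ∈ Nilmanifold.circle.Γ := by
  change Multiplicative.toAdd (Multiplicative.ofAdd (n : ℝ)) ∈ AddSubgroup.zmultiples (1 : ℝ)
  rw [toAdd_ofAdd]
  exact ⟨n, by simp⟩

/-- Every element of the circle group is a `circleElt t` with `t` central (trivially), i.e.
`t ↦ circleElt t` maps onto the centre. [folklore] -/
theorem exists_eq_circleElt_of_mem_center {z : Nilmanifold.circle.G}
    (_hz : z ∈ Subgroup.center Nilmanifold.circle.G) : ∃ t : ℝ, Nilmanifold.circleElt t = z := by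
  obtain ⟨r, hr⟩ := Nilmanifold.exists_eq_circleElt z
  exact ⟨r, hr.symm⟩

/-- `t ↦ circleElt t` is continuous. [folklore] -/
theorem continuous_circleElt : Continuous fun t : ℝ => Nilmanifold.circleElt t :=
  continuous_ofAdd

end Summit.Parity.GeneralizedHardyLittlewood.GreenTaoLevelTwoMNTwoCentralTranslation
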